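import Mathlib
import Literature.NumberTheory.LFunctions.Zhang2022.TypedSection16ALeaves
import Literature.NumberTheory.LFunctions.Zhang2022.Section16Eq162Edge
import Literature.NumberTheory.LFunctions.Zhang2022.Section16ResidueDischarge
import Literature.NumberTheory.LFunctions.Zhang2022.Section8Lemma84Core
import HarnessLib

/-!
# Zhang (2022) §16, (16.12) from (16.5) and (16.10): "Inserting this into (16,5) [sic] and substituting
# `n = dl` we obtain `Φ₂(p) = (ℛ₂*Dp/φ(D)) Σ_{j=1,2} ℛ₂ⱼ𝒮₂ⱼ + o(p)`" — the ASSEMBLY EDGE, kernel-checked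

Topic `Literature/NumberTheory/LFunctions/Zhang2022` (Landau–Siegel audit tree; verdict-neutral).
Y. Zhang, *Discrete mean estimates and the Landau–Siegel zero*, arXiv:2211.02515v1 (2022)
[Zhang2022LandauSiegel] — **an unrefereed manuscript under adjudication** (ZHANG-L discharge lane, WP16,
leaf `Typed.Section16A.Eq16_12 c′` = hypothesis `h16_12` of `Skeleton.theorem1_of_leaves_v19`). The displays
referred to are CLAIM nodes of `Zhang2022/TypedSection16A.lean` ((16.5) in its `o(p)` reading `Eq16_5P`,
(16.10) `Eq16_10`, (16.12) `Eq16_12`; DAG `Z22:(16.5)`, `Z22:(16.10)`, `Z22:(16.12)`, [Z22 pp. 91–92,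
tex L4509, L4550, L4558]), stated not asserted. This theorem-only file PROVES the last step of §16 part A
as an EDGE, i.e. exactly what "Inserting this into (16.5) and substituting `n = dl`" leaves implicit:

* `sum_Ico_Ico_eq_sum_divisorsAntidiagonal` — the regrouping `Σ_{d<N}Σ_{l<N} f(d,l) = Σ_{n<N}Σ_{dl=n} f(d,l)`
  for `f` vanishing when `dl ≥ N` (the substitution "`n = dl`"; the vanishing is the support of `b₁`,
  `Typed.Section16ALeaves.b1coef_eq_zero_of_le` + `suppBound_le_bigP`, `log D ≥ 10`);
* `insertion_main_eq` — the EXACT identity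
  `Σ_{d,l<⌈P⌉} b₁(dl)χ(l)/(dl)·λ₂(d)Σ_{j=1,2}ℛ₂ⱼd^{β_j}ℳ₂(d,l;1−β_j) = Σ_{j=1,2} ℛ₂ⱼ𝒮₂ⱼ`
  (`𝒮₂ⱼ = Typed.Section16A.calS2`, [Z22 p. 92, tex L4562]);
* `eq16_12_of_insertion` — **(16.12) ⇐ (16.5)ᴾ + "the inserted error of (16.10) is `o(p)` after the
  weights"**: `Eq16_5P c′ →` [for every `ε > 0`, for all large `D` under (A):
  `|ℛ₂*|·(D/φ(D))·|Σ_{d,l<⌈P⌉} b₁(dl)χ(l)/(dl)·(𝒟₂(d,l) − λ₂(d)Σⱼℛ₂ⱼd^{β_j}ℳ₂(d,l;1−β_j))| ≤ ε`] `→ Eq16_12 c′`;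
* `eq16_12_of_eq16_5P_of_eq16_10_on_support` — **(16.12) ⇐ (16.5)ᴾ + (16.10) ON THE SUPPORT OF `b₁`**:
  the pointwise display (16.10) with its printed rate `O(ε₁) = O(exp{−c𝓛^{1/10}})`, required for all
  `d, l ≥ 1` with `dl < 2T²P^{1/2}max(P₂,P₃)` (`= 2PT⁻⁸`, the support bound of `b₁`; the printed
  hypothesis of (16.10) is `dl < P₂² = PT⁻²⁰`, which does NOT cover the support — RANGE NOTE below) and
  `(l, D) = 1` (free: `χ(l) = 0` otherwise; the printed `(dl, D) = 1` is NOT available for `d`, see the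
  note), implies the insertion hypothesis: the weights sum to `Σ_{n<P}|b₁(n)|τ₂(n)/n ≪ 𝓛^{81}`
  (`|b₁| ≤ C_bτ₃`, `Skeleton.norm_b1coef_le`; `Σ_{n≤X}τ₃(n)²/n ≪ (log X)⁹`,
  `MeanSquareMajorant.sum_tau_sq_div_le`), `|ℛ₂*| ≤ |β₁| + O(𝓛⁻¹⁰) ≪ 1` (§16.u043, the tree theorem
  `ResidueValues.step16_u043_holds`), `D/φ(D) ≤ 4e|L′(1,χ)| ≪ 𝓛²` under (A) (Lemma 5.7 of the tree,
  `Skeleton.self_div_totient_le_norm_deriv_L_one`, and `ResidueValues.norm_deriv_LFunction_one_le`), and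
  `𝓛^K exp{−c𝓛^{1/10}} → 0` (`Lemma84.pow_mul_exp_neg_tenth_le`).

RANGE NOTE (for the WP16 plan; a reading remark, not a repair of the mathematics): `b₁ = (l^{−β₃}g*(T²/l)) ∗
(χb)` is supported on `n < 2T²·P^{1/2}·max(P₂,P₃) = 2PT⁻⁸` (tree), while (16.10) is printed under
"Assume `dl < P₂²`, and `(dl,D) = 1`" (tex L4549) with `P₂² = PT⁻²⁰ < 2PT⁻⁸`; the insertion into (16.5)
needs (16.10) for every `(d,l)` with `b₁(dl)χ(l) ≠ 0`, i.e. on the whole support and for `d` not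
necessarily prime to `D`. The only use the text makes of the range is "Note that `P₄/d > T`", which holds
for `d < 2PT⁻⁸` as well (`P₄/d > T⁶t₀/2`). The edge below therefore asks for (16.10) on the support; any
proof of (16.10) in a range `⊇` the support plugs in. (The manuscript's own remark at (15.15)–(15.16), tex
L4221 — "the function (15.16) also has a simple pole at `s = ρ̃ − 1`, while the residue at this point can
be regarded as an acceptable error" — suggests the honest rate of (16.10) may be polynomial in `𝓛⁻¹` times
an Euler-product weight in `dl` rather than `O(ε₁)` uniformly; `eq16_12_of_insertion` is stated so that
such a summed/weighted version plugs in equally.)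

No new definitions, no named facts, no `sorry`; (16.5), (16.10) are hypotheses, never asserted. Nothing here
bears on Theorems 1–2 of the source or on Landau–Siegel zeros.

## References

* Y. Zhang, arXiv:2211.02515v1 (2022), §16 (16.5) p. 91 tex L4509, (16.10)–(16.12) p. 92 tex L4549–L4565;
  §15 (15.15)–(15.17) p. 85 tex L4217–L4230 (the parallel step); §5 Lemma 5.7.
  [cite: Zhang2022LandauSiegel, §16 (16.12) p.92]
-/

noncomputable section

open Complex Real
open Literature.NumberTheory.LFunctions.Zhang2022
open Literature.NumberTheory.LFunctions.Zhang2022.Skeleton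
open Literature.NumberTheory.LFunctions.Zhang2022.Typed.Section16ALeaves

namespace Literature.NumberTheory.LFunctions.Zhang2022.Typed.Section16A

/-! ## The substitution `n = dl`: regrouping a double sum over `d, l < N` by the product -/

/-- **"substituting `n = dl`"**: for `f` vanishing at every `(d,l)` with `d, l ≥ 1`, `dl ≥ N`,
`Σ_{1≤d<N} Σ_{1≤l<N} f(d,l) = Σ_{1≤n<N} Σ_{(d,l): dl=n} f(d,l)` (the pairs with `dl < N` are exactly the
divisor pairs of the `n < N`; the others contribute `0`). [cite: Zhang2022LandauSiegel, §16 (16.12) p.92] -/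
theorem sum_Ico_Ico_eq_sum_divisorsAntidiagonal {M : Type*} [AddCommMonoid M] (N : ℕ)
    (f : ℕ × ℕ → M) (hf : ∀ q : ℕ × ℕ, 1 ≤ q.1 → 1 ≤ q.2 → N ≤ q.1 * q.2 → f q = 0) :
    ∑ d ∈ Finset.Ico 1 N, ∑ l ∈ Finset.Ico 1 N, f (d, l) =
      ∑ n ∈ Finset.Ico 1 N, ∑ q ∈ n.divisorsAntidiagonal, f q := by
  classical
  rw [← Finset.sum_product', ← Finset.sum_filter_add_sum_filter_not (Finset.Ico 1 N ×ˢ Finset.Ico 1 N)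
      (fun q : ℕ × ℕ => q.1 * q.2 < N)]
  have hzero : ∑ q ∈ (Finset.Ico 1 N ×ˢ Finset.Ico 1 N).filter (fun q : ℕ × ℕ => ¬ q.1 * q.2 < N),
      f q = 0 := Finset.sum_eq_zero fun q hq => by
    simp only [Finset.mem_filter, Finset.mem_product, Finset.mem_Ico, not_lt] at hq
    exact hf q hq.1.1.1 hq.1.2.1 hq.2
  rw [hzero, add_zero,
    show (∑ n ∈ Finset.Ico 1 N, ∑ q ∈ n.divisorsAntidiagonal, f q) =
      ∑ x ∈ (Finset.Ico 1 N).sigma (fun n => n.divisorsAntidiagonal), f x.2 from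
      (Finset.sum_sigma (Finset.Ico 1 N) (fun n => n.divisorsAntidiagonal)
        (fun x : (_ : ℕ) × (ℕ × ℕ) => f x.2)).symm]
  refine Finset.sum_nbij' (fun q => (⟨q.1 * q.2, q⟩ : (_ : ℕ) × (ℕ × ℕ))) (fun x => x.2) ?_ ?_ ?_ ?_ ?_
  · intro q hq
    simp only [Finset.mem_filter, Finset.mem_product, Finset.mem_Ico] at hq
    obtain ⟨⟨⟨h1, -⟩, ⟨h2, -⟩⟩, hN⟩ := hq
    simp only [Finset.mem_sigma, Finset.mem_Ico, Nat.mem_divisorsAntidiagonal]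
    have hne : q.1 * q.2 ≠ 0 := Nat.mul_ne_zero (by omega) (by omega)
    exact ⟨⟨Nat.one_le_iff_ne_zero.mpr hne, hN⟩, trivial, hne⟩
  · intro x hx
    simp only [Finset.mem_sigma, Finset.mem_Ico, Nat.mem_divisorsAntidiagonal] at hx
    obtain ⟨⟨-, hN⟩, hprod, hne⟩ := hx
    have h1 : x.2.1 ≠ 0 := fun h => hne (by rw [← hprod, h, zero_mul])
    have h2 : x.2.2 ≠ 0 := fun h => hne (by rw [← hprod, h, mul_zero])
    have hlt : x.2.1 * x.2.2 < N := by rw [hprod]; exact hN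
    simp only [Finset.mem_filter, Finset.mem_product, Finset.mem_Ico]
    refine ⟨⟨⟨Nat.one_le_iff_ne_zero.mpr h1, lt_of_le_of_lt ?_ hlt⟩,
      ⟨Nat.one_le_iff_ne_zero.mpr h2, lt_of_le_of_lt ?_ hlt⟩⟩, hlt⟩
    · exact Nat.le_mul_of_pos_right _ (Nat.pos_of_ne_zero h2)
    · exact Nat.le_mul_of_pos_left _ (Nat.pos_of_ne_zero h1)
  · intro q _; rfl
  · intro x hx
    simp only [Finset.mem_sigma, Finset.mem_Ico, Nat.mem_divisorsAntidiagonal] at hx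
    obtain ⟨-, hprod, -⟩ := hx
    ext <;> simp [hprod]
  · intro q _; rfl

/-! ## Thresholds -/

/-- `L₀ ≤ log D` once `D ≥ ⌈exp L₀⌉₊`. [folklore] -/
private theorem le_ell_of_ceil_exp_le {L₀ : ℝ} {D : ℕ} (hD : ⌈Real.exp L₀⌉₊ ≤ D) : L₀ ≤ ell D := by
  have h : Real.exp L₀ ≤ D := le_trans (Nat.le_ceil _) (by exact_mod_cast hD)
  exact (Real.le_log_iff_exp_le (lt_of_lt_of_le (Real.exp_pos _) h)).mpr h

section Main

variable (c' : ℝ)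

/-! ## The exact insertion identity -/

/-- **"substituting `n = dl`", the exact identity**: for `log D ≥ 10` (so that `b₁(n) = 0` for `n ≥ P`,
`Typed.Section16ALeaves.suppBound_le_bigP`),
`Σ_{d<⌈P⌉}Σ_{l<⌈P⌉} b₁(dl)χ(l)/(dl)·λ₂(d)Σ_{j=1,2}ℛ₂ⱼd^{β_j}ℳ₂(d,l;1−β_j) = Σ_{j=1,2} ℛ₂ⱼ𝒮₂ⱼ` with
`𝒮₂ⱼ = Σ_{n<⌈P⌉} b₁(n)/n Σ_{n=dl} λ₂(d)d^{β_j}χ(l)ℳ₂(d,l;1−β_j)` (`calS2`). [cite: Zhang2022LandauSiegel, §16 (16.12) p.92] -/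
theorem insertion_main_eq {D : ℕ} [NeZero D] (χ : DirichletCharacter ℂ D) (hℓ : 10 ≤ ell D) :
    ∑ d ∈ Finset.Ico 1 ⌈bigP D⌉₊, ∑ l ∈ Finset.Ico 1 ⌈bigP D⌉₊,
        b1coef c' χ (d * l) * χ (l : ZMod D) / ((d : ℂ) * l) *
          (lam2 c' χ d 1 * ∑ j ∈ ({1, 2} : Finset ℕ),
            calR2 c' χ j * (d : ℂ) ^ betaJ c' D j * calM2 c' χ d l (1 - betaJ c' D j)) =
      ∑ j ∈ ({1, 2} : Finset ℕ), calR2 c' χ j * calS2 c' χ j := by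
  set N : ℕ := ⌈bigP D⌉₊ with hN
  -- support: `b₁(dl) = 0` once `dl ≥ N ≥ P`
  have hsupp : ∀ q : ℕ × ℕ, N ≤ q.1 * q.2 → b1coef c' χ (q.1 * q.2) = 0 := by
    intro q hq
    refine b1coef_eq_zero_of_le c' χ ((suppBound_le_bigP hℓ).trans ?_)
    exact (Nat.le_ceil _).trans (by exact_mod_cast hq)
  -- the summand, per `j`
  set g : ℕ → ℕ × ℕ → ℂ := fun j q =>
    b1coef c' χ (q.1 * q.2) / ((q.1 : ℂ) * q.2) *
      (lam2 c' χ q.1 1 * (q.1 : ℂ) ^ betaJ c' D j * χ (q.2 : ZMod D) *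
        calM2 c' χ q.1 q.2 (1 - betaJ c' D j)) with hg
  have hg0 : ∀ j (q : ℕ × ℕ), 1 ≤ q.1 → 1 ≤ q.2 → N ≤ q.1 * q.2 → g j q = 0 := by
    intro j q _ _ hq
    simp only [hg, hsupp q hq, zero_div, zero_mul]
  -- `𝒮₂ⱼ` regrouped over `(d, l)`
  have hS : ∀ j : ℕ, calS2 c' χ j = ∑ d ∈ Finset.Ico 1 N, ∑ l ∈ Finset.Ico 1 N, g j (d, l) := by
    intro j
    rw [sum_Ico_Ico_eq_sum_divisorsAntidiagonal N (g j) (hg0 j), calS2]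
    refine Finset.sum_congr rfl fun n _ => ?_
    rw [Finset.mul_sum]
    refine Finset.sum_congr rfl fun q hq => ?_
    have hprod : q.1 * q.2 = n := (Nat.mem_divisorsAntidiagonal.mp hq).1
    simp only [hg]
    rw [hprod, show ((q.1 : ℂ) * q.2) = (n : ℂ) by rw [← hprod]; push_cast; ring]
  -- distribute
  simp_rw [hS, Finset.mul_sum]
  conv_rhs => rw [Finset.sum_comm]
  refine Finset.sum_congr rfl fun d _ => ?_
  conv_rhs => rw [Finset.sum_comm]
  refine Finset.sum_congr rfl fun l _ => Finset.sum_congr rfl fun j _ => ?_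
  simp only [hg]
  ring

/-! ## (16.12) from (16.5)ᴾ and the summed insertion error -/

/-- **(16.12) ⇐ (16.5)ᴾ + the insertion error is `o(p)`** (§16 p. 92, tex L4558: "Inserting this into (16,5)
and substituting `n = dl` we obtain (16.12)"): if (16.5) holds in its `o(p)` reading (`Eq16_5P`) and the
error made by replacing `𝒟₂(d,l)` by the main term of (16.10) inside the weighted double sum of (16.5) is
small after the prefactor — `|ℛ₂*|·(D/φ(D))·|Σ_{d,l<⌈P⌉} b₁(dl)χ(l)/(dl)·(𝒟₂(d,l) − λ₂(d)Σⱼℛ₂ⱼd^{β_j}ℳ₂(d,l;1−β_j))| ≤ ε`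
for every `ε > 0`, all large `D`, under (A) — then (16.12) `Eq16_12 c′` holds. Pure bookkeeping:
the exact identity `insertion_main_eq` and the triangle inequality.
[cite: Zhang2022LandauSiegel, §16 (16.12) p.92] -/
theorem eq16_12_of_insertion (h5 : Eq16_5P c')
    (hIns : ∀ ε : ℝ, 0 < ε → ForAllLarge fun D _ χ => AssumptionA D χ →
      ‖calR2star c' χ‖ * ((D : ℝ) / (Nat.totient D : ℝ)) *
        ‖∑ d ∈ Finset.Ico 1 ⌈bigP D⌉₊, ∑ l ∈ Finset.Ico 1 ⌈bigP D⌉₊,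
            b1coef c' χ (d * l) * χ (l : ZMod D) / ((d : ℂ) * l) *
              (calD2 c' χ d l - lam2 c' χ d 1 * ∑ j ∈ ({1, 2} : Finset ℕ),
                calR2 c' χ j * (d : ℂ) ^ betaJ c' D j * calM2 c' χ d l (1 - betaJ c' D j))‖ ≤ ε) :
    Eq16_12 c' := by
  intro ε hε
  have hε2 : 0 < ε / 2 := by positivity
  obtain ⟨D₁, h₁⟩ := (h5 (ε / 2) hε2).and (hIns (ε / 2) hε2)
  refine ⟨max D₁ ⌈Real.exp 10⌉₊, fun D _ χ hD hq hp hA p hpW => ?_⟩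
  have hD₁ : D₁ ≤ D := le_trans (le_max_left _ _) hD
  have hℓ : 10 ≤ ell D := le_ell_of_ceil_exp_le (le_trans (le_max_right _ _) hD)
  obtain ⟨e5, eI⟩ := h₁ D χ hD₁ hq hp
  have h5p := e5 hA p hpW
  have hIp := eI hA
  set N : ℕ := ⌈bigP D⌉₊ with hN
  -- names
  set R : ℂ := calR2star c' χ with hR
  set pref : ℂ := R * ((D : ℝ) * p : ℝ) / (Nat.totient D : ℂ) with hpref
  set E : ℕ → ℕ → ℂ := fun d l => calD2 c' χ d l - lam2 c' χ d 1 * ∑ j ∈ ({1, 2} : Finset ℕ),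
    calR2 c' χ j * (d : ℂ) ^ betaJ c' D j * calM2 c' χ d l (1 - betaJ c' D j) with hE
  set w : ℕ → ℕ → ℂ := fun d l => b1coef c' χ (d * l) * χ (l : ZMod D) / ((d : ℂ) * l) with hw
  set S : ℂ := ∑ d ∈ Finset.Ico 1 N, ∑ l ∈ Finset.Ico 1 N, w d l * calD2 c' χ d l with hS
  set S' : ℂ := ∑ d ∈ Finset.Ico 1 N, ∑ l ∈ Finset.Ico 1 N,
    w d l * (lam2 c' χ d 1 * ∑ j ∈ ({1, 2} : Finset ℕ),
      calR2 c' χ j * (d : ℂ) ^ betaJ c' D j * calM2 c' χ d l (1 - betaJ c' D j)) with hS'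
  set Serr : ℂ := ∑ d ∈ Finset.Ico 1 N, ∑ l ∈ Finset.Ico 1 N, w d l * E d l with hSerr
  have hmain : S' = ∑ j ∈ ({1, 2} : Finset ℕ), calR2 c' χ j * calS2 c' χ j :=
    insertion_main_eq c' χ hℓ
  have hsplit : S = S' + Serr := by
    simp only [hS, hS', hSerr, ← Finset.sum_add_distrib]
    refine Finset.sum_congr rfl fun d _ => Finset.sum_congr rfl fun l _ => ?_
    simp only [hE]
    ring
  -- the decomposition of the (16.12)-difference
  have hdecomp : Phi2p c' χ p - pref * ∑ j ∈ ({1, 2} : Finset ℕ), calR2 c' χ j * calS2 c' χ j =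
      (Phi2p c' χ p - pref * S) + pref * Serr := by
    rw [← hmain, hsplit]; ring
  -- the prefactor's norm
  have hφ0 : 0 < (Nat.totient D : ℝ) := by exact_mod_cast Nat.totient_pos.mpr (NeZero.pos D)
  have hp0 : (0 : ℝ) ≤ p := Nat.cast_nonneg _
  have hnpref : ‖pref‖ = ‖R‖ * ((D : ℝ) / (Nat.totient D : ℝ)) * p := by
    simp only [hpref]
    rw [norm_div, norm_mul, Complex.norm_real, Complex.norm_natCast, Real.norm_of_nonneg (by positivity)]
    field_simp
  calc ‖Phi2p c' χ p - calR2star c' χ * ((D : ℝ) * p : ℝ) / (Nat.totient D : ℂ) *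
          ∑ j ∈ ({1, 2} : Finset ℕ), calR2 c' χ j * calS2 c' χ j‖
      = ‖(Phi2p c' χ p - pref * S) + pref * Serr‖ := by rw [← hdecomp]
    _ ≤ ‖Phi2p c' χ p - pref * S‖ + ‖pref * Serr‖ := norm_add_le _ _
    _ ≤ ε / 2 * p + ‖pref‖ * ‖Serr‖ := by
        refine add_le_add ?_ (norm_mul_le _ _)
        have h5p' := h5p
        simp only [hS, hw, hpref, hR, Finset.mul_sum] at h5p' ⊢
        convert h5p' using 4
    _ = ε / 2 * p + p * (‖R‖ * ((D : ℝ) / (Nat.totient D : ℝ)) * ‖Serr‖) := by rw [hnpref]; ring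
    _ ≤ ε / 2 * p + p * (ε / 2) := by
        refine add_le_add le_rfl (mul_le_mul_of_nonneg_left ?_ hp0)
        simpa only [hSerr, hw, hE, hR] using hIp
    _ = ε * p := by ring

/-! ## The summed insertion error from the pointwise (16.10) on the support of `b₁` -/

/-- `τ₂(n) ≤ τ₃(n)` (`τ₃(n) = Σ_{d∣n}τ₂(d) ≥ τ₂(n)`). [folklore] -/
private theorem tau_two_le_tau_three (n : ℕ) : MeanSquareMajorant.tau 2 n ≤ MeanSquareMajorant.tau 3 n := by
  rcases Nat.eq_zero_or_pos n with rfl | hn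
  · simp
  · rw [show (3 : ℕ) = 2 + 1 from rfl, MeanSquareMajorant.tau_succ_apply 2 n]
    exact Finset.single_le_sum (f := fun d => MeanSquareMajorant.tau 2 d)
      (fun d _ => MeanSquareMajorant.tau_nonneg 2 d) (Nat.mem_divisors_self n hn.ne')

/-- **The weights of the insertion sum to a power of `𝓛`**: for `log D ≥ 10`,
`Σ_{d<⌈P⌉}Σ_{l<⌈P⌉} |b₁(dl)|/(dl) ≤ C_b·M·(2𝓛⁹)⁹` (`= Σ_{n<P}|b₁(n)|τ₂(n)/n` by the substitution `n = dl`;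
`|b₁| ≤ C_bτ₃`, `τ₂ ≤ τ₃`, `Σ_{n≤X}τ₃(n)²/n ≤ M(log X)⁹`, `log ⌈P⌉ ≤ 2𝓛⁹`).
[cite: Zhang2022LandauSiegel, §16 (16.12) p.92] -/
theorem sum_weights_le {D : ℕ} [NeZero D] (χ : DirichletCharacter ℂ D) (hℓ : 10 ≤ ell D) :
    ∑ d ∈ Finset.Ico 1 ⌈bigP D⌉₊, ∑ l ∈ Finset.Ico 1 ⌈bigP D⌉₊, ‖b1coef c' χ (d * l)‖ / ((d : ℝ) * l) ≤
      ((1 + ‖iota2‖) * (‖iota3‖ + ‖iota4‖)) * MeanSquareMajorant.majorantConst (3 ^ 2) (2 * 3) *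
        (2 * ell D ^ 9) ^ (3 ^ 2) := by
  set N : ℕ := ⌈bigP D⌉₊ with hN
  set Cb : ℝ := (1 + ‖iota2‖) * (‖iota3‖ + ‖iota4‖) with hCb
  have hCb0 : 0 ≤ Cb := by positivity
  have hℓ2 : 2 ≤ ell D := by linarith
  -- substitution `n = dl`
  have hsupp : ∀ q : ℕ × ℕ, 1 ≤ q.1 → 1 ≤ q.2 → N ≤ q.1 * q.2 →
      ‖b1coef c' χ (q.1 * q.2)‖ / ((q.1 : ℝ) * q.2) = 0 := by
    intro q _ _ hq
    rw [b1coef_eq_zero_of_le c' χ ((suppBound_le_bigP hℓ).trans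
      ((Nat.le_ceil _).trans (by exact_mod_cast hq))), norm_zero, zero_div]
  rw [sum_Ico_Ico_eq_sum_divisorsAntidiagonal N
    (fun q : ℕ × ℕ => ‖b1coef c' χ (q.1 * q.2)‖ / ((q.1 : ℝ) * q.2)) hsupp]
  -- each fibre: `Σ_{dl=n} |b₁(n)|/n = |b₁(n)|τ₂(n)/n ≤ C_b τ₃(n)²/n`
  have hfib : ∀ n ∈ Finset.Ico 1 N,
      ∑ q ∈ n.divisorsAntidiagonal, ‖b1coef c' χ (q.1 * q.2)‖ / ((q.1 : ℝ) * q.2) ≤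
        Cb * (MeanSquareMajorant.tau 3 n ^ 2 / n) := by
    intro n hn
    have hn1 : 1 ≤ n := (Finset.mem_Ico.mp hn).1
    have hn0 : (0 : ℝ) < n := by exact_mod_cast hn1
    have hterm : ∀ q ∈ n.divisorsAntidiagonal,
        ‖b1coef c' χ (q.1 * q.2)‖ / ((q.1 : ℝ) * q.2) = ‖b1coef c' χ n‖ / n := by
      intro q hq
      have hprod : q.1 * q.2 = n := (Nat.mem_divisorsAntidiagonal.mp hq).1
      rw [hprod, show ((q.1 : ℝ) * q.2) = (n : ℝ) by rw [← hprod]; push_cast; ring]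
    rw [Finset.sum_congr rfl hterm, Finset.sum_const, nsmul_eq_mul]
    have hcard : (n.divisorsAntidiagonal.card : ℝ) = MeanSquareMajorant.tau 2 n := by
      rw [MeanSquareMajorant.tau_two_apply, ← Nat.map_div_right_divisors, Finset.card_map]
    rw [hcard]
    have hb := Skeleton.norm_b1coef_le c' χ hℓ2 n
    rw [one_mul] at hb
    have hτ2 := tau_two_le_tau_three n
    have hτ0 : 0 ≤ MeanSquareMajorant.tau 2 n := MeanSquareMajorant.tau_nonneg _ _
    calc MeanSquareMajorant.tau 2 n * (‖b1coef c' χ n‖ / n)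
        ≤ MeanSquareMajorant.tau 3 n * (Cb * MeanSquareMajorant.tau 3 n / n) := by
          refine mul_le_mul hτ2 (div_le_div_of_nonneg_right hb hn0.le)
            (div_nonneg (norm_nonneg _) hn0.le) (MeanSquareMajorant.tau_nonneg _ _)
      _ = Cb * (MeanSquareMajorant.tau 3 n ^ 2 / n) := by ring
  refine (Finset.sum_le_sum hfib).trans ?_
  rw [← Finset.mul_sum]
  -- `Σ_{n<N} τ₃(n)²/n ≤ M (log (N-1))⁹ ≤ M (2𝓛⁹)⁹`
  have hP1 : (3 : ℝ) ≤ bigP D := by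
    have h9 : (10 : ℝ) ^ 9 ≤ ell D ^ 9 := by gcongr
    have := Real.add_one_le_exp (ell D ^ 9)
    rw [bigP]; linarith
  have hN3 : 3 ≤ N := by
    have h : (3 : ℝ) ≤ (N : ℝ) := hP1.trans (Nat.le_ceil _)
    exact_mod_cast h
  have hX2 : 2 ≤ N - 1 := by omega
  have hIco : Finset.Ico 1 N = Finset.Icc 1 (N - 1) := by
    ext n; simp only [Finset.mem_Ico, Finset.mem_Icc]; omega
  rw [hIco]
  have hsum := MeanSquareMajorant.sum_tau_sq_div_le 3 hX2
  have hlog : Real.log ((N - 1 : ℕ) : ℝ) ≤ 2 * ell D ^ 9 := by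
    have hN1 : ((N - 1 : ℕ) : ℝ) ≤ bigP D := by
      have h1 : ((N - 1 : ℕ) : ℝ) = (N : ℝ) - 1 := by
        rw [Nat.cast_sub (by omega)]; push_cast; ring
      rw [h1, hN]
      have := Nat.ceil_lt_add_one (show (0 : ℝ) ≤ bigP D by positivity)
      linarith
    have hpos : (0 : ℝ) < ((N - 1 : ℕ) : ℝ) := by exact_mod_cast (show 0 < N - 1 by omega)
    calc Real.log ((N - 1 : ℕ) : ℝ) ≤ Real.log (bigP D) := Real.log_le_log hpos hN1
      _ = ell D ^ 9 := by rw [bigP, Real.log_exp]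
      _ ≤ 2 * ell D ^ 9 := by nlinarith [pow_nonneg (show (0:ℝ) ≤ ell D by linarith) 9]
  have hlog0 : 0 ≤ Real.log ((N - 1 : ℕ) : ℝ) := Real.log_natCast_nonneg _
  have hM0 : 0 ≤ MeanSquareMajorant.majorantConst (3 ^ 2) (2 * 3) :=
    (MeanSquareMajorant.majorantConst_pos _ _).le
  calc Cb * ∑ n ∈ Finset.Icc 1 (N - 1), MeanSquareMajorant.tau 3 n ^ 2 / (n : ℝ)
      ≤ Cb * (MeanSquareMajorant.majorantConst (3 ^ 2) (2 * 3) * Real.log ((N - 1 : ℕ) : ℝ) ^ (3 ^ 2)) :=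
        mul_le_mul_of_nonneg_left hsum hCb0
    _ ≤ Cb * (MeanSquareMajorant.majorantConst (3 ^ 2) (2 * 3) * (2 * ell D ^ 9) ^ (3 ^ 2)) := by
        gcongr
    _ = _ := by ring

/-- **`|ℛ₂*| ≤ K`** for all large `D` under (A), with `K = π(1 + 5|c′|π) + C` (`ℛ₂* = β₁ + O(𝓛⁻¹⁰)`, §16.u043
of the tree, `ResidueValues.step16_u043_holds`; `|β₁| = α|1 − 5c′α𝓛|`, `α = π𝓛⁻⁹ ≤ π`, `α𝓛 ≤ π`).
[cite: Zhang2022LandauSiegel, §16 p.95] -/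
theorem norm_calR2star_le : ∃ K : ℝ, 0 ≤ K ∧ ForAllLarge fun D _ χ => AssumptionA D χ →
    ‖calR2star c' χ‖ ≤ K := by
  obtain ⟨C, D₀, hC⟩ := ResidueValues.step16_u043_holds c'
  refine ⟨π * (1 + 5 * |c'| * π) + max C 0, by positivity, max D₀ ⌈Real.exp 1⌉₊,
    fun D _ χ hD hq hp hA => ?_⟩
  have hD₀ : D₀ ≤ D := le_trans (le_max_left _ _) hD
  have hℓ1 : 1 ≤ ell D := le_ell_of_ceil_exp_le (le_trans (le_max_right _ _) hD)
  have hℓ0 : 0 < ell D := by linarith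
  have h43 := (hC D χ hD₀ hq hp hA).1
  have hα0 : 0 ≤ alpha D := (alpha_pos_of_ell_pos hℓ0).le
  have hαπ : alpha D ≤ π := by
    rw [alpha, bigP, Real.log_exp]
    exact div_le_self Real.pi_pos.le (one_le_pow₀ hℓ1)
  have hαℓ : alpha D * ell D ≤ π := by
    rw [alpha, bigP, Real.log_exp]
    rw [div_mul_eq_mul_div, div_le_iff₀ (by positivity)]
    have h8 : ell D ≤ ell D ^ 9 := le_self_pow₀ hℓ1 (by norm_num)
    nlinarith [Real.pi_pos]
  have hβ : ‖beta1 c' D‖ ≤ π * (1 + 5 * |c'| * π) := by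
    rw [norm_beta1 c' hα0]
    have h1 : |1 - 5 * c' * alpha D * ell D| ≤ 1 + 5 * |c'| * π := by
      calc |1 - 5 * c' * alpha D * ell D| ≤ |(1 : ℝ)| + |5 * c' * alpha D * ell D| := abs_sub _ _
        _ = 1 + 5 * |c'| * (alpha D * ell D) := by
            rw [abs_one, show 5 * c' * alpha D * ell D = 5 * c' * (alpha D * ell D) by ring,
              abs_mul, abs_mul, abs_of_nonneg (by norm_num : (0:ℝ) ≤ 5),
              abs_of_nonneg (by positivity : 0 ≤ alpha D * ell D)]
        _ ≤ 1 + 5 * |c'| * π := by gcongr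
    exact mul_le_mul hαπ h1 (abs_nonneg _) Real.pi_pos.le
  have hC10 : C * (ell D ^ 10)⁻¹ ≤ max C 0 := by
    have h10 : 1 ≤ ell D ^ 10 := one_le_pow₀ hℓ1
    calc C * (ell D ^ 10)⁻¹ ≤ max C 0 * (ell D ^ 10)⁻¹ :=
          mul_le_mul_of_nonneg_right (le_max_left _ _) (by positivity)
      _ ≤ max C 0 * 1 := mul_le_mul_of_nonneg_left (inv_le_one_of_one_le₀ h10) (le_max_right _ _)
      _ = max C 0 := mul_one _
  calc ‖calR2star c' χ‖ = ‖beta1 c' D + (calR2star c' χ - beta1 c' D)‖ := by ring_nf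
    _ ≤ ‖beta1 c' D‖ + ‖calR2star c' χ - beta1 c' D‖ := norm_add_le _ _
    _ ≤ π * (1 + 5 * |c'| * π) + max C 0 := add_le_add hβ (h43.trans hC10)

/-- **`D/φ(D) ≤ 16e^{11/2}𝓛²`** for all large `D` under (A): Lemma 5.7 of the tree
(`D/φ(D) ≤ 4e|L′(1,χ)|`, `Skeleton.self_div_totient_le_norm_deriv_L_one`) and `|L′(1,χ)| ≤ 4e^{9/2}𝓛²`
(`ResidueValues.norm_deriv_LFunction_one_le`). [cite: Zhang2022LandauSiegel, §5 Lemma 5.7] -/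
theorem self_div_totient_le_ell_sq : ForAllLarge fun D _ χ => AssumptionA D χ →
    (D : ℝ) / (Nat.totient D : ℝ) ≤ 16 * Real.exp (11 / 2) * ell D ^ 2 := by
  obtain ⟨D₀, hD₀⟩ := Skeleton.self_div_totient_le_norm_deriv_L_one
  refine ⟨max D₀ ⌈Real.exp 3⌉₊, fun D _ χ hD hq hp hA => ?_⟩
  have hℓ3 : 3 ≤ ell D := le_ell_of_ceil_exp_le (le_trans (le_max_right _ _) hD)
  have h1 := hD₀ D χ (le_trans (le_max_left _ _) hD) hq hp hA
  have h2 := ResidueValues.norm_deriv_LFunction_one_le χ hℓ3 hp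
  have hℓ0 : 0 ≤ ell D := by linarith
  calc (D : ℝ) / (Nat.totient D : ℝ) ≤ 4 * Real.exp 1 * ‖deriv χ.LFunction 1‖ := h1
    _ ≤ 4 * Real.exp 1 * (2 * Real.exp (9 / 2) * (1 + ell D) * ell D) := by gcongr
    _ ≤ 4 * Real.exp 1 * (2 * Real.exp (9 / 2) * (2 * ell D) * ell D) := by gcongr; linarith
    _ = 16 * (Real.exp 1 * Real.exp (9 / 2)) * ell D ^ 2 := by ring
    _ = 16 * Real.exp (11 / 2) * ell D ^ 2 := by rw [← Real.exp_add]; norm_num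

/-- `K·𝓛^m·exp{−c𝓛^{1/10}} ≤ ε` for all large `D` (`𝓛^{m+1}e^{−c𝓛^{1/10}} ≤ (10(m+1))!/c^{10(m+1)}`,
`Lemma84.pow_mul_exp_neg_tenth_le`). [cite: Zhang2022LandauSiegel, §7 p.40 (ε₁)] -/
theorem pow_mul_eps1_eventually_le (K : ℝ) (m : ℕ) {c : ℝ} (hc : 0 < c) {ε : ℝ} (hε : 0 < ε) :
    ∃ D₀ : ℕ, ∀ D : ℕ, D₀ ≤ D → K * ell D ^ m * Real.exp (-c * ell D ^ (1 / 10 : ℝ)) ≤ ε := by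
  set M : ℝ := ((10 * (m + 1)).factorial : ℝ) / c ^ (10 * (m + 1)) with hM
  have hM0 : 0 ≤ M := by positivity
  refine ⟨⌈Real.exp (max 1 (max K 0 * M / ε))⌉₊, fun D hD => ?_⟩
  have hℓ : max 1 (max K 0 * M / ε) ≤ ell D := le_ell_of_ceil_exp_le hD
  have hℓ1 : 1 ≤ ell D := le_trans (le_max_left _ _) hℓ
  have hℓ0 : 0 < ell D := by linarith
  have hKM : max K 0 * M / ε ≤ ell D := le_trans (le_max_right _ _) hℓ
  have hkey := Lemma84.pow_mul_exp_neg_tenth_le hc hℓ0.le (m + 1)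
  rw [← hM] at hkey
  have hexp0 : 0 < Real.exp (-c * ell D ^ (1 / 10 : ℝ)) := Real.exp_pos _
  have e1 : Real.exp (-c * ell D ^ (1 / 10 : ℝ)) = Real.exp (-(c * ell D ^ (1 / 10 : ℝ))) := by
    rw [neg_mul]
  calc K * ell D ^ m * Real.exp (-c * ell D ^ (1 / 10 : ℝ))
      ≤ max K 0 * ell D ^ m * Real.exp (-c * ell D ^ (1 / 10 : ℝ)) := by
        gcongr; exact le_max_left _ _
    _ = max K 0 * (ell D ^ (m + 1) * Real.exp (-(c * ell D ^ (1 / 10 : ℝ)))) / ell D := by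
        rw [e1, pow_succ]; field_simp
    _ ≤ max K 0 * M / ell D := by gcongr
    _ ≤ ε := by
        rw [div_le_iff₀ hℓ0]
        have := (div_le_iff₀ hε).mp hKM
        linarith

/-- **(16.12) ⇐ (16.5)ᴾ + (16.10) on the support of `b₁`** (§16 p. 92): the pointwise display (16.10) with
its printed rate `O(ε₁)`, `ε₁ = exp{−c𝓛^{1/10}}`, for all `d, l ≥ 1` with `dl < 2T²P^{1/2}max(P₂,P₃)`
(the support bound of `b₁`, see the RANGE NOTE in the module docstring) and `(l,D) = 1`, together with
(16.5) in the `o(p)` reading, gives (16.12): the inserted error is at most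
`|ℛ₂*|·(D/φ(D))·Σ_{d,l}|b₁(dl)|/(dl)·Cε₁ ≪ 𝓛²·𝓛^{81}·ε₁ = o(1)` (`sum_weights_le`, `norm_calR2star_le`,
`self_div_totient_le_ell_sq`, `pow_mul_eps1_eventually_le`), then `eq16_12_of_insertion`.
[cite: Zhang2022LandauSiegel, §16 (16.10)–(16.12) p.92] -/
theorem eq16_12_of_eq16_5P_of_eq16_10_on_support (h5 : Eq16_5P c')
    (h10 : ∃ c : ℝ, 0 < c ∧ ∃ C : ℝ, ForAllLarge fun D _ χ => AssumptionA D χ →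
      ∀ d l : ℕ, 1 ≤ d → 1 ≤ l →
        ((d * l : ℕ) : ℝ) < 2 * bigT D ^ 2 * (bigP D ^ (1 / 2 : ℝ) * max (Skeleton.P2 D) (P3 D)) →
        Nat.Coprime l D →
        ‖calD2 c' χ d l - lam2 c' χ d 1 * ∑ j ∈ ({1, 2} : Finset ℕ),
            calR2 c' χ j * (d : ℂ) ^ betaJ c' D j * calM2 c' χ d l (1 - betaJ c' D j)‖ ≤
          C * Real.exp (-c * ell D ^ (1 / 10 : ℝ))) :
    Eq16_12 c' := by
  refine eq16_12_of_insertion c' h5 fun ε hε => ?_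
  obtain ⟨c, hc, C, h10'⟩ := h10
  obtain ⟨K, hK0, hR⟩ := norm_calR2star_le c'
  set Cb : ℝ := (1 + ‖iota2‖) * (‖iota3‖ + ‖iota4‖) with hCb
  set Mτ : ℝ := MeanSquareMajorant.majorantConst (3 ^ 2) (2 * 3) with hMτ
  have hMτ0 : 0 ≤ Mτ := (MeanSquareMajorant.majorantConst_pos _ _).le
  -- the constant in front of `𝓛^{2+81} ε₁`
  set K' : ℝ := K * (16 * Real.exp (11 / 2)) * (max C 0 * (Cb * Mτ * 2 ^ (3 ^ 2))) with hK'
  obtain ⟨D₂, hD₂⟩ := pow_mul_eps1_eventually_le K' (2 + 9 * 3 ^ 2) hc hε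
  obtain ⟨D₁, h₁⟩ := (h10'.and hR).and (self_div_totient_le_ell_sq)
  refine ⟨max (max D₁ D₂) ⌈Real.exp 10⌉₊, fun D _ χ hD hq hp hA => ?_⟩
  have hD₁ : D₁ ≤ D := le_trans (le_trans (le_max_left _ _) (le_max_left _ _)) hD
  have hD₂' : D₂ ≤ D := le_trans (le_trans (le_max_right _ _) (le_max_left _ _)) hD
  have hℓ : 10 ≤ ell D := le_ell_of_ceil_exp_le (le_trans (le_max_right _ _) hD)
  have hℓ0 : 0 ≤ ell D := by linarith
  obtain ⟨⟨e10, eR⟩, eφ⟩ := h₁ D χ hD₁ hq hp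
  have h10p := e10 hA
  have hRle := eR hA
  have hφle := eφ hA
  set N : ℕ := ⌈bigP D⌉₊ with hN
  set ε₁ : ℝ := Real.exp (-c * ell D ^ (1 / 10 : ℝ)) with hε₁
  have hε₁0 : 0 < ε₁ := Real.exp_pos _
  -- pointwise: `‖w(d,l) E(d,l)‖ ≤ |b₁(dl)|/(dl) · C ε₁` for `1 ≤ d, l`
  have hpt : ∀ d ∈ Finset.Ico 1 N, ∀ l ∈ Finset.Ico 1 N,
      ‖b1coef c' χ (d * l) * χ (l : ZMod D) / ((d : ℂ) * l) *
          (calD2 c' χ d l - lam2 c' χ d 1 * ∑ j ∈ ({1, 2} : Finset ℕ),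
            calR2 c' χ j * (d : ℂ) ^ betaJ c' D j * calM2 c' χ d l (1 - betaJ c' D j))‖ ≤
        ‖b1coef c' χ (d * l)‖ / ((d : ℝ) * l) * (max C 0 * ε₁) := by
    intro d hd l hl
    have hd1 : 1 ≤ d := (Finset.mem_Ico.mp hd).1
    have hl1 : 1 ≤ l := (Finset.mem_Ico.mp hl).1
    have hdl0 : (0 : ℝ) < (d : ℝ) * l := by positivity
    rw [norm_mul, norm_div, norm_mul, show ‖((d : ℂ) * l)‖ = (d : ℝ) * l by
      rw [norm_mul, Complex.norm_natCast, Complex.norm_natCast]]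
    by_cases hb : b1coef c' χ (d * l) = 0
    · rw [hb]; simp
    by_cases hχ : χ (l : ZMod D) = 0
    · rw [hχ]; simp
      positivity
    -- `b₁(dl) ≠ 0` forces `dl` inside the support; `χ(l) ≠ 0` forces `(l,D) = 1`
    have hrange : ((d * l : ℕ) : ℝ) < 2 * bigT D ^ 2 * (bigP D ^ (1 / 2 : ℝ) * max (Skeleton.P2 D) (P3 D)) := by
      by_contra hge
      exact hb (b1coef_eq_zero_of_le c' χ (not_lt.mp hge))
    have hcop : Nat.Coprime l D := by
      have hu : IsUnit (l : ZMod D) := by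
        by_contra hnu
        exact hχ (χ.map_nonunit hnu)
      exact (ZMod.isUnit_iff_coprime l D).mp hu
    have hE := h10p d l hd1 hl1 hrange hcop
    have hχ1 : ‖χ (l : ZMod D)‖ ≤ 1 := DirichletCharacter.norm_le_one χ _
    calc ‖b1coef c' χ (d * l)‖ * ‖χ (l : ZMod D)‖ / ((d : ℝ) * l) *
          ‖calD2 c' χ d l - lam2 c' χ d 1 * ∑ j ∈ ({1, 2} : Finset ℕ),
            calR2 c' χ j * (d : ℂ) ^ betaJ c' D j * calM2 c' χ d l (1 - betaJ c' D j)‖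
        ≤ ‖b1coef c' χ (d * l)‖ * 1 / ((d : ℝ) * l) * (C * ε₁) := by
          refine mul_le_mul ?_ hE (norm_nonneg _) (by positivity)
          exact div_le_div_of_nonneg_right (mul_le_mul_of_nonneg_left hχ1 (norm_nonneg _)) hdl0.le
      _ ≤ ‖b1coef c' χ (d * l)‖ / ((d : ℝ) * l) * (max C 0 * ε₁) := by
          rw [mul_one]; gcongr; exact le_max_left _ _
  -- sum up
  have hsum : ‖∑ d ∈ Finset.Ico 1 N, ∑ l ∈ Finset.Ico 1 N,
      b1coef c' χ (d * l) * χ (l : ZMod D) / ((d : ℂ) * l) *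
        (calD2 c' χ d l - lam2 c' χ d 1 * ∑ j ∈ ({1, 2} : Finset ℕ),
          calR2 c' χ j * (d : ℂ) ^ betaJ c' D j * calM2 c' χ d l (1 - betaJ c' D j))‖ ≤
      (Cb * Mτ * (2 * ell D ^ 9) ^ (3 ^ 2)) * (max C 0 * ε₁) := by
    refine (norm_sum_le _ _).trans ?_
    refine (Finset.sum_le_sum fun d hd => (norm_sum_le _ _).trans
      (Finset.sum_le_sum fun l hl => hpt d hd l hl)).trans ?_
    simp_rw [← Finset.sum_mul]
    exact mul_le_mul_of_nonneg_right (sum_weights_le c' χ hℓ) (by positivity)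
  have hfinal := hD₂ D hD₂'
  calc ‖calR2star c' χ‖ * ((D : ℝ) / (Nat.totient D : ℝ)) *
        ‖∑ d ∈ Finset.Ico 1 N, ∑ l ∈ Finset.Ico 1 N,
          b1coef c' χ (d * l) * χ (l : ZMod D) / ((d : ℂ) * l) *
            (calD2 c' χ d l - lam2 c' χ d 1 * ∑ j ∈ ({1, 2} : Finset ℕ),
              calR2 c' χ j * (d : ℂ) ^ betaJ c' D j * calM2 c' χ d l (1 - betaJ c' D j))‖
      ≤ K * (16 * Real.exp (11 / 2) * ell D ^ 2) *
          ((Cb * Mτ * (2 * ell D ^ 9) ^ (3 ^ 2)) * (max C 0 * ε₁)) := by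
        have hφ0 : 0 ≤ (D : ℝ) / (Nat.totient D : ℝ) := by positivity
        exact mul_le_mul (mul_le_mul hRle hφle hφ0 hK0) hsum (norm_nonneg _) (by positivity)
    _ = K' * ell D ^ (2 + 9 * 3 ^ 2) * ε₁ := by
        simp only [hK']; ring
    _ ≤ ε := hfinal

end Main

end Literature.NumberTheory.LFunctions.Zhang2022.Typed.Section16A
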